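/-
Copyright (c) 2026 the pub-hodgecm-mathlib formalisation cell (harness21).  Prover seat hodgecm-mathlib-K2Liu-p09 (g6): Track B «K2-LIT»,
hLiu418 = stmt-HodgeConjecture-24832; LEAD F0P6-plan RULING M-158d «A7-val road (σ)», file V1d′ (the flat family, EXPLICIT: the Iwasawa projection exported).
-/
import Summits.HodgeConjecture.HodgeConjecture.Theorems.K2LiuA7ValueSiegelLaw   -- ★ V1d p859834 (`exists_flatFamily`; brings ★ V1 `localSiegelCharacter_eq_cpow_mul`, ★ B2)
import HarnessLib

/-!
# Crux `HLiu418`, road `K2_Liu`, organ A7-val, file V1d′: THE `K₀`-FLAT FAMILY WITH ITS IWASAWA PROJECTION EXPORTED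

Cell `hodgecm-mathlib`, crux item hLiu418 = `stmt-HodgeConjecture-24832`; squad K2 ∕ K2Liu; prover K2Liu-p09 (g6), organ lead A7-val.  THEOREMS ONLY; lane
`--supports stmt-HodgeConjecture-24832` (count-neutral helper).  Generic D10 currency, any rank `n`.  ★ V1d `exists_flatFamily` only asserts `∃ f`; the
V7a-WITH-TAIL computation (K2Liu-p07 (g3), σ19-(Sp)) needs the FORMULA `f s x = |det_Δ p(x)|^{s − s₁} · φ x` with the Iwasawa projection `x ↦ p(x) ∈ P_Δ(F_v)`
(`x ∈ p(x)·K₀`) and its modulus laws in hand: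
* **`exists_iwasawaProj`** — an Iwasawa projection `pI : H_v → P_Δ(F_v)` for `H_v = P_Δ·K₀` with `|det_Δ pI(p x)| = |det_Δ p| · |det_Δ pI(x)|`, `|det_Δ pI(x k)| = |det_Δ pI(x)|`,
  `|det_Δ pI(k)| = 1` (`p ∈ P_Δ`, `k ∈ K₀`; ★ B2 `absDetDelta_eq_of_mul_eq_mul`);
* **`flatFamily_explicit`** — for such a `pI` and a smooth `φ ∈ I_v(s₁, χ_v)`, `f s x := |det_Δ pI(x)|^{s − s₁} · φ x` is a smooth Siegel section of `I_v(s, χ_v)` for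
  every `s`, flat on `K₀`, with `f s₁ = φ` (the proof of ★ V1d, formula exposed).
HONEST LABEL.  `HC_CM` is proved only modulo the 7 printed citations (2 remaining named inputs: hLiu418 = `stmt-HodgeConjecture-24832`,
h413 = `stmt-HodgeConjecture-24833`) until rung 0 closes.

## References
* [KudlaSweet1997] S. Kudla, W. J. Sweet, §1 (standard∕flat sections).
* [Casselman1980] W. Casselman, Compositio Math. 40 (1980), §3.
-/

set_option autoImplicit false
set_option linter.dupNamespace false -- the mandated namespace repeats `HodgeConjecture.HodgeConjecture`

noncomputable section

open scoped Classical NNReal ENNReal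
open NumberField IsDedekindDomain MeasureTheory Topology
open Literature.NumberTheory.GaloisRepresentations Literature.NumberTheory.GaloisRepresentations.IsNonarchimedeanLocalField
open Literature.NumberTheory.Automorphic Literature.NumberTheory.Automorphic.UnitaryGroup
open Literature.NumberTheory.GelbartRogawski1991.UnitaryDualPair.LocalSplitting
open Literature.NumberTheory.K2Lit.LocalSiegelDoubled
open Summit.HodgeConjecture.HodgeConjecture.Cruxes.HLiu418.K2LiuQRationalDefs
open Summit.HodgeConjecture.HodgeConjecture.Cruxes.HLiu418.K2LiuLocalLFactorDefs
open Summit.HodgeConjecture.HodgeConjecture.Cruxes.HLiu418.K2LiuLocalSiegel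
open Summit.HodgeConjecture.HodgeConjecture.Cruxes.HLiu418.K2LiuLocalIntertwiningProperty
open Summit.HodgeConjecture.HodgeConjecture.Cruxes.HLiu418.K2LiuFlatSiegelFamilies
open Summit.HodgeConjecture.HodgeConjecture.Cruxes.HLiu418.K2LiuA7ValueFunctional

namespace Summit.HodgeConjecture.HodgeConjecture.Cruxes.HLiu418.K2LiuA7ValueFlatFamilyExplicit

variable (F : Type) [Field F] [NumberField F] (E : Type) [Field E] [NumberField E] [Algebra F E]
  [Algebra.IsQuadraticExtension F E] (c : E ≃ₐ[F] E)
  {δ : E} (hcδ : c δ = -δ) (hδ : δ ≠ 0) {d : F} (hd : δ * δ = algebraMap F E d) (v : HeightOneSpectrum (𝓞 F)) (n : ℕ)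
  {T₀ : Matrix (Fin n) (Fin n) F} (hT₀ : T₀.IsSymm) {JD : Matrix (Fin (n + n)) (Fin (n + n)) E} (hJD : JD = (gramD F n T₀).map (algebraMap F E))
  (χv : ∀ w : PlacesOver E v, (w.1.adicCompletion E)ˣ →* ℂˣ)

include hcδ hδ hd hT₀ hJD in
/-- **AN IWASAWA PROJECTION AND ITS MODULUS LAWS**: for `H_v = P_Δ(F_v)·K₀` (`K₀` compact) there is `pI : H_v → H_v` with `pI x ∈ P_Δ`, `x ∈ pI(x)·K₀`, and
`|det_Δ pI(p x)| = |det_Δ p|·|det_Δ pI(x)|` (`p ∈ P_Δ`), `|det_Δ pI(x k)| = |det_Δ pI(x)|` and `|det_Δ pI(k)| = 1` (`k ∈ K₀`) — ★ B2 `absDetDelta_eq_of_mul_eq_mul`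
(`|det_Δ|` is `1` on the compact `P_Δ ∩ K₀`). [cite: Casselman1980, §3] [cite: KudlaSweet1997, §1] -/
theorem exists_iwasawaProj (K₀ : Subgroup (UnitaryGroup.localPi E c (n + n) JD v))
    (hK₀ : IsCompact (K₀ : Set (UnitaryGroup.localPi E c (n + n) JD v)) ∧ IsOpen (K₀ : Set (UnitaryGroup.localPi E c (n + n) JD v)))
    (hIw : ∀ x : UnitaryGroup.localPi E c (n + n) JD v, ∃ p, IsSiegelDelta F E c hcδ hδ hd v n hT₀ hJD p ∧ ∃ k ∈ K₀, x = p * k) :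
    ∃ pI : UnitaryGroup.localPi E c (n + n) JD v → UnitaryGroup.localPi E c (n + n) JD v,
      (∀ x, IsSiegelDelta F E c hcδ hδ hd v n hT₀ hJD (pI x)) ∧ (∀ x, ∃ k ∈ K₀, x = pI x * k) ∧
      (∀ p x, IsSiegelDelta F E c hcδ hδ hd v n hT₀ hJD p → absDetDelta F E c v n (pI (p * x)) = absDetDelta F E c v n p * absDetDelta F E c v n (pI x)) ∧
      (∀ x k, k ∈ K₀ → absDetDelta F E c v n (pI (x * k)) = absDetDelta F E c v n (pI x)) ∧
      (∀ k, k ∈ K₀ → absDetDelta F E c v n (pI k) = 1) := by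
  choose pI hpI kI hkI hxI using hIw
  have hν_left : ∀ (p x : UnitaryGroup.localPi E c (n + n) JD v), IsSiegelDelta F E c hcδ hδ hd v n hT₀ hJD p →
      absDetDelta F E c v n (pI (p * x)) = absDetDelta F E c v n p * absDetDelta F E c v n (pI x) := fun p x hp => by
    rw [← absDetDelta_mul F E c hcδ hδ hd v n hT₀ hJD p (pI x) (hpI x)]
    exact absDetDelta_eq_of_mul_eq_mul F E c hcδ hδ hd v n hT₀ hJD K₀ hK₀.1 (hpI _) (hp.mul (hpI x)) (hkI _) (hkI x)
      (by rw [← hxI (p * x), mul_assoc, ← hxI x])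
  have hν_right : ∀ (x k : UnitaryGroup.localPi E c (n + n) JD v), k ∈ K₀ →
      absDetDelta F E c v n (pI (x * k)) = absDetDelta F E c v n (pI x) := fun x k hk =>
    absDetDelta_eq_of_mul_eq_mul F E c hcδ hδ hd v n hT₀ hJD K₀ hK₀.1 (hpI _) (hpI x) (hkI _) (K₀.mul_mem (hkI x) hk)
      (by rw [← hxI (x * k), ← mul_assoc, ← hxI x])
  have hν_one : ∀ k : UnitaryGroup.localPi E c (n + n) JD v, k ∈ K₀ → absDetDelta F E c v n (pI k) = 1 := fun k hk => by
    have h := hν_right 1 k hk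
    rw [one_mul] at h
    rw [h]
    have h1 := absDetDelta_eq_of_mul_eq_mul F E c hcδ hδ hd v n hT₀ hJD K₀ hK₀.1 (hpI 1) (isSiegelDelta_one F E c hcδ hδ hd v n hT₀ hJD) (hkI 1) K₀.one_mem
      (by rw [← hxI 1, one_mul])
    rw [h1, absDetDelta_one]
  exact ⟨pI, hpI, fun x => ⟨kI x, hkI x, hxI x⟩, hν_left, hν_right, hν_one⟩

include hcδ hδ hd hT₀ hJD in
/-- **THE FLAT FAMILY, EXPLICITLY**: for an Iwasawa projection `pI` with the three modulus laws and a smooth `φ ∈ I_v(s₁, χ_v)`, the family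
`f s x := |det_Δ pI(x)|^{s − s₁} · φ x` consists of smooth Siegel sections `f s ∈ I_v(s, χ_v)`, is flat on `K₀`, and `f s₁ = φ` (the proof of ★ V1d `exists_flatFamily`,
formula exposed for the V7a-with-tail computation `f s (w u) = |det_Δ pI(w u)|^{s−s₁} φ(w u)`). [cite: KudlaSweet1997, §1] [cite: Casselman1980, §3] -/
theorem flatFamily_explicit (K₀ : Subgroup (UnitaryGroup.localPi E c (n + n) JD v))
    (hK₀ : IsCompact (K₀ : Set (UnitaryGroup.localPi E c (n + n) JD v)) ∧ IsOpen (K₀ : Set (UnitaryGroup.localPi E c (n + n) JD v)))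
    (pI : UnitaryGroup.localPi E c (n + n) JD v → UnitaryGroup.localPi E c (n + n) JD v)
    (hν_left : ∀ p x, IsSiegelDelta F E c hcδ hδ hd v n hT₀ hJD p →
      absDetDelta F E c v n (pI (p * x)) = absDetDelta F E c v n p * absDetDelta F E c v n (pI x))
    (hν_right : ∀ x k, k ∈ K₀ → absDetDelta F E c v n (pI (x * k)) = absDetDelta F E c v n (pI x))
    (hν_one : ∀ k, k ∈ K₀ → absDetDelta F E c v n (pI k) = 1)
    (s₁ : ℂ) {φ : UnitaryGroup.localPi E c (n + n) JD v → ℂ} (hφ : IsLocalSiegelSection F E c hcδ hδ hd v n hT₀ hJD χv s₁ φ) (hφsm : IsSmooth F E c v n φ) :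
    (∀ s, IsLocalSiegelSection F E c hcδ hδ hd v n hT₀ hJD χv s fun x => ((absDetDelta F E c v n (pI x) : ℝ) : ℂ) ^ (s - s₁) * φ x) ∧
      (∀ s, IsSmooth F E c v n fun x => ((absDetDelta F E c v n (pI x) : ℝ) : ℂ) ^ (s - s₁) * φ x) ∧
      (∀ s s' : ℂ, ∀ k ∈ K₀, ((absDetDelta F E c v n (pI k) : ℝ) : ℂ) ^ (s - s₁) * φ k = ((absDetDelta F E c v n (pI k) : ℝ) : ℂ) ^ (s' - s₁) * φ k) ∧
      (fun x => ((absDetDelta F E c v n (pI x) : ℝ) : ℂ) ^ (s₁ - s₁) * φ x) = φ := by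
  obtain ⟨U, hU⟩ := hφsm
  refine ⟨fun s p hp x => ?_, fun s => ?_, fun s s' k hk => ?_, ?_⟩
  · -- Siegel
    show ((absDetDelta F E c v n (pI (p * x)) : ℝ) : ℂ) ^ (s - s₁) * φ (p * x) =
      localSiegelCharacter F E c v n χv s p * (((absDetDelta F E c v n (pI x) : ℝ) : ℂ) ^ (s - s₁) * φ x)
    rw [hν_left p x hp, hφ p hp x, Complex.ofReal_mul, Complex.mul_cpow_ofReal_nonneg (absDetDelta_nonneg F E c v n p) (absDetDelta_nonneg F E c v n _),
      localSiegelCharacter_eq_cpow_mul F E c hcδ hδ hd v n hT₀ hJD χv hp s s₁]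
    ring
  · -- smooth
    refine ⟨⟨K₀, hK₀.2⟩ ⊓ U, fun x u hu => ?_⟩
    have hu' : u ∈ K₀ ∧ u ∈ (U : Subgroup _) := by simpa [OpenSubgroup.coe_inf] using hu
    show ((absDetDelta F E c v n (pI (x * u)) : ℝ) : ℂ) ^ (s - s₁) * φ (x * u) = ((absDetDelta F E c v n (pI x) : ℝ) : ℂ) ^ (s - s₁) * φ x
    rw [hν_right x u hu'.1, hU x u hu'.2]
  · -- flat
    rw [hν_one k hk, Complex.ofReal_one, Complex.one_cpow, Complex.one_cpow]
  · funext x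
    rw [sub_self, Complex.cpow_zero, one_mul]

end Summit.HodgeConjecture.HodgeConjecture.Cruxes.HLiu418.K2LiuA7ValueFlatFamilyExplicit

end
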